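import Literature.Topology.FourManifolds.BCSConstruction
import Literature.Topology.FourManifolds.HomotopySpheresStablyParallelizable
import Literature.Topology.FourManifolds.SpinProofs
import Mathlib.Topology.Instances.Matrix
import HarnessLib

/-!
# The boundary connected sum of s-parallelizable manifolds is s-parallelizable

M. Kervaire, J. Milnor, *Groups of homotopy spheres I*, Ann. of Math. 77 (1963), §2, p. 508
(with Milnor, *Differentiable manifolds which are homotopy spheres* (1959), Lemma 2.4 cited
there): "if `W₁`, `W₂` are s-parallelizable then so is `W₁ ♮ W₂`". The proof written here is the
elementary gluing of stable frame fields: stable framings `F¹`, `F²` of `T(W_S) ⊕ ℝ`, `T(W_T) ⊕ ℝ`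
push forward along the gluing embeddings `ι₁`, `ι₂` to frame fields over the two open pieces of
`W_U = W_S ♮ W_T`; on the overlap — which lies in the single half-disc chart
`Θ = ι₁ ∘ k_S : ℍ ∖ 0 → W_U` — they differ by a continuous transition matrix `g` (continuity read
in the chart trivialisation of `T W_U`); since the shell `{r₀ ≤ ‖v‖ ≤ r₁}` retracts inside
itself onto one point (it is star-shaped in the chart), `g` restricted to the outer sphere
extends continuously over the `T`-side as `g ∘ Θ ∘ c ∘ Θ⁻¹` (`c` the radial contraction) and a
constant; twisting `F²` by this extension and pasting with `F¹` along the outer sphere gives a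
global stable frame field of `W_U`.

* `NullCobordism.BCSSetup.isStablyParallelizable_glued` — the theorem.

Everything is proved; no named facts.

## References

* M. A. Kervaire, J. W. Milnor, *Groups of homotopy spheres: I*, Ann. of Math. (2) 77 (1963),
  §2 p. 508. [KervaireMilnorAnnals1963]
* J. Milnor, *Differentiable manifolds which are homotopy spheres* (mimeographed, 1959),
  Lemma 2.4. [Milnor1959HomotopySpheres]
* J. Milnor, J. Stasheff, *Characteristic Classes*, Princeton 1974, §2–§3 (vector bundles,
  frames, continuity of linear combinations of sections). [MilnorStasheff1974]
* N. Steenrod, *The Topology of Fibre Bundles*, Princeton 1951, §5–§8.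
-/

noncomputable section

open scoped Manifold ContDiff Topology Matrix
open Set Function Topology TopologicalSpace Bundle

namespace Literature.Topology.FourManifolds

/-! ### General facts on continuous vector fields along maps -/

section VectorFields

variable {E H : Type*} [NormedAddCommGroup E] [NormedSpace ℝ E] [TopologicalSpace H]
  {I : ModelWithCorners ℝ E H} {M : Type*} [TopologicalSpace M] [ChartedSpace H M]
  [IsManifold I 1 M] {X : Type*} [TopologicalSpace X]

/-- **Linear combinations of continuous vector fields along a map are continuous** (the tangent
bundle is a vector bundle: its local trivialisations are fibrewise linear; Milnor–Stasheff 1974, §2).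
If `x ↦ (f x, wⱼ x)` is continuous into `TM` on `t` for each `j` and the coefficients `aⱼ` are
continuous on `t`, then so is `x ↦ (f x, Σⱼ aⱼ x • wⱼ x)`. [cite: MilnorStasheff1974, §2] -/
theorem continuousOn_totalSpaceMk_sum {ι : Type*} [Fintype ι] {f : X → M} {w : ι → X → E}
    {a : ι → X → ℝ} {t : Set X} (hf : ContinuousOn f t)
    (hw : ∀ j, ContinuousOn (fun x => (TotalSpace.mk' E (f x) (w j x) : TangentBundle I M)) t)
    (ha : ∀ j, ContinuousOn (a j) t) :
    ContinuousOn (fun x => (TotalSpace.mk' E (f x) (∑ j, a j x • w j x) : TangentBundle I M)) t := by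
  intro x₀ hx₀
  rw [FiberBundle.continuousWithinAt_totalSpace]
  refine ⟨hf x₀ hx₀, ?_⟩
  set e := trivializationAt E (TangentSpace I) (f x₀) with he
  have hbase : e.baseSet ∈ 𝓝 (f x₀) :=
    e.open_baseSet.mem_nhds (mem_baseSet_trivializationAt E (TangentSpace I) (f x₀))
  have hev : ∀ᶠ x in 𝓝[t] x₀, f x ∈ e.baseSet := hf x₀ hx₀ hbase
  have hc : ∀ j, ContinuousWithinAt (fun x => (e (TotalSpace.mk' E (f x) (w j x))).2) t x₀ := fun j =>
    ((FiberBundle.continuousWithinAt_totalSpace E _).1 (hw j x₀ hx₀)).2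
  have heq : (fun x => ∑ j, a j x • (e (TotalSpace.mk' E (f x) (w j x))).2) =ᶠ[𝓝[t] x₀]
      fun x => (e (TotalSpace.mk' E (f x) (∑ j, a j x • w j x))).2 := by
    filter_upwards [hev] with x hx
    set L : TangentSpace I (f x) →ₗ[ℝ] E := (e.linear ℝ hx).mk' _ with hL
    have hL' : ∀ y : TangentSpace I (f x), (e (TotalSpace.mk' E (f x) y)).2 = L y := fun y =>
      (IsLinearMap.mk'_apply (e.linear ℝ hx) y).symm
    simp only [hL', map_sum]
    exact Finset.sum_congr rfl fun j _ => (L.map_smul (a j x) (w j x)).symm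
  refine ContinuousWithinAt.congr_of_eventuallyEq ?_ heq.symm (heq.symm.self_of_nhdsWithin hx₀)
  exact tendsto_finsetSum Finset.univ fun j _ => (ha j x₀ hx₀).smul (hc j)

/-- **Vector fields along maps into an open submanifold**: continuity into `TU` and into `TM`
agree (`T U = T M|_U`, same local trivialisations; Lawson–Michelsohn, Ch. II §1).
[cite: MilnorStasheff1974, §2] -/
theorem continuousOn_totalSpaceMk_opens_iff (U : Opens M) {f : X → U} {v : X → E} {t : Set X}
    (hf : ContinuousOn f t) :
    ContinuousOn (fun x => (TotalSpace.mk' E (f x) (v x) : TangentBundle I U)) t ↔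
      ContinuousOn (fun x => (TotalSpace.mk' E ((f x : U) : M) (v x) : TangentBundle I M)) t := by
  have key : ∀ x₀ x, ((trivializationAt E (TangentSpace I) (f x₀))
        (TotalSpace.mk' E (f x) (v x) : TangentBundle I U)).2 =
      ((trivializationAt E (TangentSpace I) ((f x₀ : U) : M))
        (TotalSpace.mk' E ((f x : U) : M) (v x) : TangentBundle I M)).2 := by
    intro x₀ x
    change tangentCoordChange I (f x) (f x₀) (f x) (v x) =
      tangentCoordChange I ((f x : U) : M) ((f x₀ : U) : M) ((f x : U) : M) (v x)
    rw [tangentCoordChange_opens]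
  constructor
  · intro h x₀ hx₀
    rw [FiberBundle.continuousWithinAt_totalSpace]
    refine ⟨continuous_subtype_val.continuousWithinAt.comp (hf x₀ hx₀) (mapsTo_univ _ _), ?_⟩
    have h2 := ((FiberBundle.continuousWithinAt_totalSpace E _).1 (h x₀ hx₀)).2
    exact h2.congr (fun x _ => (key x₀ x).symm) (key x₀ x₀).symm
  · intro h x₀ hx₀
    rw [FiberBundle.continuousWithinAt_totalSpace]
    refine ⟨hf x₀ hx₀, ?_⟩
    have h2 := ((FiberBundle.continuousWithinAt_totalSpace E _).1 (h x₀ hx₀)).2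
    exact h2.congr (fun x _ => key x₀ x) (key x₀ x₀)

omit [IsManifold I 1 M] in
/-- Vector fields along maps into the model space `H`: continuity into `TH = H × E` is
continuity of the two components (`tangentBundleModelSpaceHomeomorph`). [folklore] -/
theorem continuousOn_totalSpaceMk_modelSpace {f : X → H} {v : X → E} {t : Set X}
    (hf : ContinuousOn f t) (hv : ContinuousOn v t) :
    ContinuousOn (fun x => (TotalSpace.mk' E (f x) (v x) : TangentBundle I H)) t := by
  have h : (fun x => (TotalSpace.mk' E (f x) (v x) : TangentBundle I H)) =
      (tangentBundleModelSpaceHomeomorph I).symm ∘ fun x => (f x, v x) := by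
    funext x
    rfl
  rw [h]
  exact (tangentBundleModelSpaceHomeomorph I).symm.continuous.comp_continuousOn (hf.prodMk hv)

omit [IsManifold I 1 M] in
/-- The vector component of a continuous vector field along a map into the model space is
continuous. [folklore] -/
theorem continuousOn_snd_of_totalSpaceMk_modelSpace {f : X → H} {v : X → E} {t : Set X}
    (h : ContinuousOn (fun x => (TotalSpace.mk' E (f x) (v x) : TangentBundle I H)) t) :
    ContinuousOn v t := by
  have hv : v = (fun p : ModelProd H E => p.2) ∘ (tangentBundleModelSpaceHomeomorph I) ∘
      fun x => (TotalSpace.mk' E (f x) (v x) : TangentBundle I H) := by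
    funext x
    rfl
  rw [hv]
  exact continuous_snd.comp_continuousOn ((tangentBundleModelSpaceHomeomorph I).continuous.comp_continuousOn h)

end VectorFields

/-! ### Smooth open embeddings as differentiable partial homeomorphisms -/

section OpenEmb

variable {EM HM EN HN : Type*} [NormedAddCommGroup EM] [NormedSpace ℝ EM] [TopologicalSpace HM]
  [NormedAddCommGroup EN] [NormedSpace ℝ EN] [TopologicalSpace HN]
  {I : ModelWithCorners ℝ EM HM} {J : ModelWithCorners ℝ EN HN}
  {M : Type*} [TopologicalSpace M] [ChartedSpace HM M]
  {N : Type*} [TopologicalSpace N] [ChartedSpace HN N]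

/-- The chart of an open smooth embedding is differentiable in both directions. [folklore] -/
theorem mdifferentiable_openEmbeddingChart [Nonempty M] [IsManifold I ∞ M] [IsManifold J ∞ N]
    {f : M → N} (hf : Manifold.IsSmoothEmbedding I J ∞ f) (ho : IsOpen (range f)) :
    (openEmbeddingChart hf ho).MDifferentiable I J :=
  ⟨(contMDiffOn_openEmbeddingChart hf ho).mdifferentiableOn (by simp),
    (contMDiffOn_openEmbeddingChart_symm hf ho).mdifferentiableOn (by simp)⟩

/-- The inverse of the subtype chart of an open subset sends a point to itself. [folklore] -/
theorem openPartialHomeomorphSubtypeCoe_symm_apply (U : Opens M) [Nonempty U] {x : M} (hx : x ∈ U) :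
    (U.openPartialHomeomorphSubtypeCoe inferInstance).symm x = ⟨x, hx⟩ := by
  have ht : x ∈ (U.openPartialHomeomorphSubtypeCoe inferInstance).target := by
    rw [Opens.openPartialHomeomorphSubtypeCoe_target]; exact hx
  apply Subtype.ext
  have h := (U.openPartialHomeomorphSubtypeCoe inferInstance).right_inv ht
  rwa [Opens.openPartialHomeomorphSubtypeCoe_coe] at h

/-- The subtype chart of an open subset is differentiable in both directions. [folklore] -/
theorem mdifferentiable_openPartialHomeomorphSubtypeCoe (U : Opens M) [Nonempty U] :
    (U.openPartialHomeomorphSubtypeCoe inferInstance).MDifferentiable I I := by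
  refine ⟨?_, ?_⟩
  · rw [Opens.openPartialHomeomorphSubtypeCoe_source]
    exact ((contMDiff_subtype_val (n := 1)).contMDiffOn (s := univ)).mdifferentiableOn one_ne_zero
  · exact (contMDiffOn_openPartialHomeomorphSubtypeCoe_symm (I := I) U inferInstance).mdifferentiableOn
      (by simp)

end OpenEmb

/-! ### The overlap chart of a boundary connected sum -/

namespace NullCobordism

namespace BCSSetup

variable {n : ℕ} (X : BCSSetup n)

/-- The chart of `W_S` by the half-disc `k_S` (source `ℍ`, target `k_S(ℍ)`). [folklore] -/
def kSChart : OpenPartialHomeomorph (EuclideanHalfSpace (n + 2)) X.cS.W :=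
  openEmbeddingChart X.isSmoothEmbedding_kS.1 X.isSmoothEmbedding_kS.2

/-- The chart of `W_U` by the first gluing map (source the punctured piece, target its range).
[folklore] -/
def ι₁Chart : OpenPartialHomeomorph ↥(puncture X.kS) X.P :=
  openEmbeddingChart X.W.h₁ X.W.h₁o

/-- The chart of `W_U` by the second gluing map. [folklore] -/
def ι₂Chart : OpenPartialHomeomorph ↥(puncture X.kT) X.P :=
  openEmbeddingChart X.W.h₂ X.W.h₂o

/-- The subtype chart of the punctured piece `W_S ∖ {k_S 0}`. [folklore] -/
def pChart : OpenPartialHomeomorph ↥(puncture X.kS) X.cS.W :=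
  (puncture X.kS).openPartialHomeomorphSubtypeCoe inferInstance

/-- **The overlap chart** `Θ = ι₁ ∘ k_S : ℍ ∖ 0 → W_U` of the boundary connected sum, an open
partial homeomorphism from the model half space onto the open neighbourhood
`ι₁(k_S(ℍ ∖ 0))` of the glued region. [cite: KervaireMilnorAnnals1963, §2 p. 508] -/
def Θ : OpenPartialHomeomorph (EuclideanHalfSpace (n + 2)) X.P :=
  X.kSChart.trans (X.pChart.symm.trans X.ι₁Chart)

/-- The overlap chart on its source: `Θ v = ι₁ (k_S v)`. [folklore] -/
theorem Θ_apply {v : EuclideanHalfSpace (n + 2)} (hv : X.kS v ∈ puncture X.kS) :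
    X.Θ v = X.W.ι₁ ⟨X.kS v, hv⟩ := by
  change X.ι₁Chart (X.pChart.symm (X.kSChart v)) = _
  rw [ι₁Chart, openEmbeddingChart_coe, kSChart, openEmbeddingChart_coe, pChart,
    openPartialHomeomorphSubtypeCoe_symm_apply _ hv]

/-- The source of the overlap chart is `{v | k_S v ≠ k_S 0} = ℍ ∖ 0`. [folklore] -/
theorem mem_Θ_source_iff (v : EuclideanHalfSpace (n + 2)) : v ∈ X.Θ.source ↔ X.kS v ∈ puncture X.kS := by
  rw [Θ, OpenPartialHomeomorph.trans_source, OpenPartialHomeomorph.trans_source, kSChart,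
    openEmbeddingChart_source, OpenPartialHomeomorph.symm_source, pChart,
    Opens.openPartialHomeomorphSubtypeCoe_target]
  simp only [univ_inter, mem_preimage, openEmbeddingChart_coe, ι₁Chart,
    openEmbeddingChart_source, preimage_univ, inter_univ]
  rfl

/-- Vectors of positive norm are in the source of the overlap chart. [folklore] -/
theorem mem_Θ_source {v : EuclideanHalfSpace (n + 2)} (hv : 0 < ‖v.val‖) : v ∈ X.Θ.source :=
  (X.mem_Θ_source_iff v).2 (X.kS_mem_puncture hv)

/-- The overlap chart is differentiable in both directions. [folklore] -/
theorem mdifferentiable_Θ : X.Θ.MDifferentiable (𝓡∂ (n + 2)) (𝓡∂ (n + 2)) :=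
  (mdifferentiable_openEmbeddingChart X.isSmoothEmbedding_kS.1 X.isSmoothEmbedding_kS.2).trans
    ((mdifferentiable_openPartialHomeomorphSubtypeCoe (I := 𝓡∂ (n + 2)) (puncture X.kS)).symm.trans
      (mdifferentiable_openEmbeddingChart X.W.h₁ X.W.h₁o))

/-- The inverse of the overlap chart is `C¹` on its target. [folklore] -/
theorem contMDiffOn_Θ_symm : ContMDiffOn (𝓡∂ (n + 2)) (𝓡∂ (n + 2)) 1 X.Θ.symm X.Θ.target := by
  have h1 : ContMDiffOn (𝓡∂ (n + 2)) (𝓡∂ (n + 2)) ∞ X.ι₁Chart.symm X.ι₁Chart.target :=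
    contMDiffOn_openEmbeddingChart_symm X.W.h₁ X.W.h₁o
  have h2 : ContMDiffOn (𝓡∂ (n + 2)) (𝓡∂ (n + 2)) ∞ X.pChart X.pChart.source := by
    rw [pChart, Opens.openPartialHomeomorphSubtypeCoe_source]
    exact contMDiff_subtype_val.contMDiffOn
  have h3 : ContMDiffOn (𝓡∂ (n + 2)) (𝓡∂ (n + 2)) ∞ X.kSChart.symm X.kSChart.target :=
    contMDiffOn_openEmbeddingChart_symm X.isSmoothEmbedding_kS.1 X.isSmoothEmbedding_kS.2
  have hsub : X.Θ.target ⊆ X.ι₁Chart.target := fun p hp => by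
    rw [Θ, OpenPartialHomeomorph.trans_target, OpenPartialHomeomorph.trans_target] at hp
    exact hp.1.1
  have h : ContMDiffOn (𝓡∂ (n + 2)) (𝓡∂ (n + 2)) ∞ (X.kSChart.symm ∘ X.pChart ∘ X.ι₁Chart.symm) X.Θ.target := by
    refine h3.comp ((h2.comp (h1.mono hsub) fun p _ => ?_)) fun p hp => ?_
    · rw [pChart, Opens.openPartialHomeomorphSubtypeCoe_source]; exact mem_univ _
    · rw [Θ, OpenPartialHomeomorph.trans_target] at hp
      exact hp.2
  exact h.of_le (by exact_mod_cast le_top)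

/-! ### Frame fields over the two pieces -/

/-- The index type of a stable frame of an `(n+2)`-manifold: `dim + 1 = n + 3` vectors. [folklore] -/
abbrev ιN (n : ℕ) : Type := Fin (n + 3)

/-- `dim + 1 = n + 3`. [folklore] -/
theorem finrank_add_one (n : ℕ) : Module.finrank ℝ (EuclideanSpace ℝ (Fin (n + 2))) + 1 = n + 3 := by
  rw [finrank_euclideanSpace_fin]

/-- A **stable frame field datum** on a manifold `W` with the half-space model: `dim W + 1`
fields of vectors of `TW × ℝ`, continuous into `TW`, with continuous real parts, linearly
independent at every point (an unpacked witness of `IsStablyParallelizable`). [folklore] -/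
structure StableFrame (W : Type) [TopologicalSpace W] [ChartedSpace (EuclideanHalfSpace (n + 2)) W]
    [IsManifold (𝓡∂ (n + 2)) 1 W] where
  /-- the vector fields -/
  s : ιN n → W → EuclideanSpace ℝ (Fin (n + 2)) × ℝ
  cont : ∀ i, Continuous fun x => (TotalSpace.mk' (EuclideanSpace ℝ (Fin (n + 2))) x (s i x).1 :
    TangentBundle (𝓡∂ (n + 2)) W)
  cont₂ : ∀ i, Continuous fun x => (s i x).2
  linearIndependent : ∀ x, LinearIndependent ℝ fun i => s i x

/-- An s-parallelizable manifold carries a stable frame field datum. [folklore] -/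
theorem nonempty_stableFrame_of_isStablyParallelizable {W : Type} [TopologicalSpace W]
    [ChartedSpace (EuclideanHalfSpace (n + 2)) W] [IsManifold (𝓡∂ (n + 2)) 1 W]
    (h : IsStablyParallelizable (𝓡∂ (n + 2)) W) : Nonempty (StableFrame (n := n) W) := by
  obtain ⟨s, hs, hs₂, hli⟩ := h
  let e : ιN n ≃ Fin (Module.finrank ℝ (EuclideanSpace ℝ (Fin (n + 2))) + 1) := finCongr (finrank_add_one n).symm
  exact ⟨⟨fun i => s (e i), fun i => hs (e i), fun i => hs₂ (e i), fun x => (hli x).comp e e.injective⟩⟩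

/-- A stable frame field datum makes the manifold s-parallelizable. [folklore] -/
theorem StableFrame.isStablyParallelizable {W : Type} [TopologicalSpace W]
    [ChartedSpace (EuclideanHalfSpace (n + 2)) W] [IsManifold (𝓡∂ (n + 2)) 1 W]
    (F : StableFrame (n := n) W) : IsStablyParallelizable (𝓡∂ (n + 2)) W := by
  let e : Fin (Module.finrank ℝ (EuclideanSpace ℝ (Fin (n + 2))) + 1) ≃ ιN n := finCongr (finrank_add_one n)
  exact ⟨fun i => F.s (e i), fun i => F.cont (e i), fun i => F.cont₂ (e i),
    fun x => (F.linearIndependent x).comp e e.injective⟩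

section Pieces

variable {MP : Type} [TopologicalSpace MP] [ChartedSpace (EuclideanSpace ℝ (Fin (n + 1))) MP]
  {cP : NullCobordism (n + 1) MP}
  (A : Opens cP.W) (ι : A → X.P) (hι : Manifold.IsSmoothEmbedding (𝓡∂ (n + 2)) (𝓡∂ (n + 2)) ∞ ι)
  (hιo : IsOpen (range ι)) (F : StableFrame (n := n) cP.W)

/-- **Push-forward of a stable frame field along a gluing embedding**: at `a ∈ A`, the vectors
`(dι_a (sᵢ a), tᵢ a)`. [cite: MilnorStasheff1974, §2] -/
def pushFrame (a : A) (i : ιN n) : EuclideanSpace ℝ (Fin (n + 2)) × ℝ :=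
  (mfderiv (𝓡∂ (n + 2)) (𝓡∂ (n + 2)) ι a (F.s i a.1).1, (F.s i a.1).2)

include hι in
/-- The push-forward frame field is continuous into `T W_U` (push-forward of a continuous vector
field along a `C¹` map, `ContinuousOn.totalSpaceMk_mfderiv`). [cite: MilnorStasheff1974, §2] -/
theorem continuous_pushFrame (i : ιN n) :
    Continuous fun a : A => (TotalSpace.mk' (EuclideanSpace ℝ (Fin (n + 2))) (ι a) (pushFrame X A ι F a i).1 :
      TangentBundle (𝓡∂ (n + 2)) X.P) := by
  -- the field restricted to the open piece is continuous into `T A = T W|_A`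
  have h1 : ContinuousOn (fun a : A => (TotalSpace.mk' (EuclideanSpace ℝ (Fin (n + 2))) a (F.s i a.1).1 :
      TangentBundle (𝓡∂ (n + 2)) A)) univ := by
    rw [continuousOn_totalSpaceMk_opens_iff (I := 𝓡∂ (n + 2)) A (f := fun a : A => a)
      continuousOn_id]
    exact ((F.cont i).comp continuous_subtype_val).continuousOn
  have h2 := ContinuousOn.totalSpaceMk_mfderiv (I := 𝓡∂ (n + 2)) (J := 𝓡∂ (n + 2)) (f := ι)
    isOpen_univ (hι.contMDiff.of_le (by exact_mod_cast le_top)).contMDiffOn (g := fun a : A => a)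
    (v := fun a : A => (F.s i a.1).1) (t := univ) h1 (mapsTo_univ _ _)
  exact continuousOn_univ.1 h2

include hι hιo in
/-- The differential of an open smooth embedding is injective. [folklore] -/
theorem injective_mfderiv_of_openEmb (a : A) :
    Function.Injective (mfderiv (𝓡∂ (n + 2)) (𝓡∂ (n + 2)) ι a) := by
  set D : EuclideanSpace ℝ (Fin (n + 2)) →L[ℝ] EuclideanSpace ℝ (Fin (n + 2)) :=
    mfderiv (𝓡∂ (n + 2)) (𝓡∂ (n + 2)) ι a with hD
  have hdet : LinearMap.det (D : EuclideanSpace ℝ (Fin (n + 2)) →ₗ[ℝ] EuclideanSpace ℝ (Fin (n + 2))) ≠ 0 :=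
    det_mfderiv_ne_zero_of_isSmoothEmbedding hι hιo a
  have hk : LinearMap.ker (D : EuclideanSpace ℝ (Fin (n + 2)) →ₗ[ℝ] EuclideanSpace ℝ (Fin (n + 2))) = ⊥ := by
    by_contra hk
    exact hdet ((LinearMap.det_eq_zero_iff_ker_ne_bot
      (f := (D : EuclideanSpace ℝ (Fin (n + 2)) →ₗ[ℝ] EuclideanSpace ℝ (Fin (n + 2))))).mpr hk)
  exact LinearMap.ker_eq_bot.1 hk

include hι hιo in
/-- The push-forward frame is linearly independent at every point (`dι_a` is injective).
[cite: MilnorStasheff1974, §2] -/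
theorem linearIndependent_pushFrame (a : A) : LinearIndependent ℝ (pushFrame X A ι F a) := by
  have hinj := injective_mfderiv_of_openEmb X A ι hι hιo a
  have hker : LinearMap.ker ((mfderiv (𝓡∂ (n + 2)) (𝓡∂ (n + 2)) ι a :
      EuclideanSpace ℝ (Fin (n + 2)) →L[ℝ] EuclideanSpace ℝ (Fin (n + 2))).toLinearMap.prodMap
      (LinearMap.id : ℝ →ₗ[ℝ] ℝ)) = ⊥ := by
    rw [LinearMap.ker_eq_bot]
    rintro ⟨v, r⟩ ⟨v', r'⟩ hvr
    have h1 : mfderiv (𝓡∂ (n + 2)) (𝓡∂ (n + 2)) ι a v = mfderiv (𝓡∂ (n + 2)) (𝓡∂ (n + 2)) ι a v' :=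
      congrArg Prod.fst hvr
    have h2 : r = r' := congrArg Prod.snd hvr
    exact Prod.ext (hinj h1) h2
  have h : pushFrame X A ι F a = ((mfderiv (𝓡∂ (n + 2)) (𝓡∂ (n + 2)) ι a :
      EuclideanSpace ℝ (Fin (n + 2)) →L[ℝ] EuclideanSpace ℝ (Fin (n + 2))).toLinearMap.prodMap
      (LinearMap.id : ℝ →ₗ[ℝ] ℝ)) ∘ fun i => F.s i a.1 := by
    funext i
    rfl
  rw [h]
  exact (F.linearIndependent a.1).map' _ hker

end Pieces

/-! ### The two frame fields on the glued manifold and their chart coordinates -/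

section Frames

variable (FS : StableFrame (n := n) X.cS.W) (FT : StableFrame (n := n) X.cT.W)

/-- The frame field of `W_U` over the first piece `U₁ = ι₁(W_S ∖ pt)`, pushed forward from `W_S`.
[cite: KervaireMilnorAnnals1963, §2 p. 508] -/
def frame₁ (p : X.P) (i : ιN n) : EuclideanSpace ℝ (Fin (n + 2)) × ℝ :=
  pushFrame X (puncture X.kS) X.W.ι₁ FS (X.ι₁Chart.symm p) i

/-- The frame field of `W_U` over the second piece `U₂ = ι₂(W_T ∖ pt)`, pushed forward from `W_T`.
[cite: KervaireMilnorAnnals1963, §2 p. 508] -/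
def frame₂ (p : X.P) (i : ιN n) : EuclideanSpace ℝ (Fin (n + 2)) × ℝ :=
  pushFrame X (puncture X.kT) X.W.ι₂ FT (X.ι₂Chart.symm p) i

/-- `ι₁Chart.target = range ι₁`. [folklore] -/
theorem ι₁Chart_target : X.ι₁Chart.target = range X.W.ι₁ := openEmbeddingChart_target _ _

/-- `ι₂Chart.target = range ι₂`. [folklore] -/
theorem ι₂Chart_target : X.ι₂Chart.target = range X.W.ι₂ := openEmbeddingChart_target _ _

/-- The first frame field is continuous into `T W_U` on `U₁`. [cite: MilnorStasheff1974, §2] -/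
theorem continuousOn_frame₁ (i : ιN n) :
    ContinuousOn (fun p => (TotalSpace.mk' (EuclideanSpace ℝ (Fin (n + 2))) p (X.frame₁ FS p i).1 :
      TangentBundle (𝓡∂ (n + 2)) X.P)) (range X.W.ι₁) := by
  have h1 := (X.continuous_pushFrame (puncture X.kS) X.W.ι₁ X.W.h₁ FS i).comp_continuousOn
    (X.ι₁Chart.continuousOn_symm.mono (by rw [ι₁Chart_target]))
  refine h1.congr fun p hp => ?_
  have hp' : p ∈ X.ι₁Chart.target := by rw [ι₁Chart_target]; exact hp
  change (TotalSpace.mk' _ p _ : TangentBundle (𝓡∂ (n + 2)) X.P) =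
    TotalSpace.mk' _ (X.W.ι₁ (X.ι₁Chart.symm p)) _
  congr 1
  exact ((X.ι₁Chart.right_inv hp').symm : p = X.ι₁Chart (X.ι₁Chart.symm p))

/-- The second frame field is continuous into `T W_U` on `U₂`. [cite: MilnorStasheff1974, §2] -/
theorem continuousOn_frame₂ (i : ιN n) :
    ContinuousOn (fun p => (TotalSpace.mk' (EuclideanSpace ℝ (Fin (n + 2))) p (X.frame₂ FT p i).1 :
      TangentBundle (𝓡∂ (n + 2)) X.P)) (range X.W.ι₂) := by
  have h1 := (X.continuous_pushFrame (puncture X.kT) X.W.ι₂ X.W.h₂ FT i).comp_continuousOn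
    (X.ι₂Chart.continuousOn_symm.mono (by rw [ι₂Chart_target]))
  refine h1.congr fun p hp => ?_
  have hp' : p ∈ X.ι₂Chart.target := by rw [ι₂Chart_target]; exact hp
  change (TotalSpace.mk' _ p _ : TangentBundle (𝓡∂ (n + 2)) X.P) =
    TotalSpace.mk' _ (X.W.ι₂ (X.ι₂Chart.symm p)) _
  congr 1
  exact ((X.ι₂Chart.right_inv hp').symm : p = X.ι₂Chart (X.ι₂Chart.symm p))

/-- The real parts of the first frame field are continuous on `U₁`. [folklore] -/
theorem continuousOn_frame₁_snd (i : ιN n) : ContinuousOn (fun p => (X.frame₁ FS p i).2) (range X.W.ι₁) :=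
  ((FS.cont₂ i).comp continuous_subtype_val).comp_continuousOn
    (X.ι₁Chart.continuousOn_symm.mono (by rw [ι₁Chart_target]))

/-- The real parts of the second frame field are continuous on `U₂`. [folklore] -/
theorem continuousOn_frame₂_snd (i : ιN n) : ContinuousOn (fun p => (X.frame₂ FT p i).2) (range X.W.ι₂) :=
  ((FT.cont₂ i).comp continuous_subtype_val).comp_continuousOn
    (X.ι₂Chart.continuousOn_symm.mono (by rw [ι₂Chart_target]))

/-- The first frame field is a frame at every point. [folklore] -/
theorem linearIndependent_frame₁ (p : X.P) : LinearIndependent ℝ (X.frame₁ FS p) :=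
  X.linearIndependent_pushFrame (puncture X.kS) X.W.ι₁ X.W.h₁ X.W.h₁o FS _

/-- The second frame field is a frame at every point. [folklore] -/
theorem linearIndependent_frame₂ (p : X.P) : LinearIndependent ℝ (X.frame₂ FT p) :=
  X.linearIndependent_pushFrame (puncture X.kT) X.W.ι₂ X.W.h₂ X.W.h₂o FT _

/-! #### Chart coordinates of frames over the overlap chart -/

/-- The differential of the inverse overlap chart at `p`, as a map of the model vector space.
[folklore] -/
def Lmap (p : X.P) : EuclideanSpace ℝ (Fin (n + 2)) →L[ℝ] EuclideanSpace ℝ (Fin (n + 2)) :=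
  mfderiv (𝓡∂ (n + 2)) (𝓡∂ (n + 2)) X.Θ.symm p

/-- The coordinate map of `T_p W_U × ℝ` in the overlap chart: `(dΘ⁻¹_p, id)`. [folklore] -/
def coordV (p : X.P) : (EuclideanSpace ℝ (Fin (n + 2)) × ℝ) →ₗ[ℝ] (EuclideanSpace ℝ (Fin (n + 2)) × ℝ) :=
  (X.Lmap p : EuclideanSpace ℝ (Fin (n + 2)) →ₗ[ℝ] EuclideanSpace ℝ (Fin (n + 2))).prodMap LinearMap.id

/-- Unfolding of the coordinate map. [folklore] -/
theorem coordV_apply (p : X.P) (w : EuclideanSpace ℝ (Fin (n + 2)) × ℝ) :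
    X.coordV p w = (X.Lmap p w.1, w.2) := rfl

/-- The coordinate map is injective over the target of the overlap chart (`dΘ⁻¹_p` is
bijective). [folklore] -/
theorem injective_coordV {p : X.P} (hp : p ∈ X.Θ.target) : Function.Injective (X.coordV p) := by
  have hb : Function.Injective (X.Lmap p) :=
    (X.mdifferentiable_Θ.symm.mfderiv_bijective (x := p) (by rw [X.Θ.symm_source]; exact hp)).1
  rintro ⟨v, r⟩ ⟨v', r'⟩ h
  rw [coordV_apply, coordV_apply] at h
  have h1 : X.Lmap p v = X.Lmap p v' := congrArg Prod.fst h
  have h2 : r = r' := congrArg Prod.snd h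
  exact Prod.ext (hb h1) h2

/-- `dim (E × ℝ) = n + 3`. [folklore] -/
theorem finrank_prod_eq : Module.finrank ℝ (EuclideanSpace ℝ (Fin (n + 2)) × ℝ) = n + 3 := by
  rw [Module.finrank_prod, finrank_euclideanSpace_fin, Module.finrank_self]

/-- A fixed linear identification `E × ℝ ≅ ℝⁿ⁺³`. [folklore] -/
def vecEquiv (n : ℕ) : (EuclideanSpace ℝ (Fin (n + 2)) × ℝ) ≃ₗ[ℝ] (ιN n → ℝ) :=
  (Module.finBasisOfFinrankEq ℝ (EuclideanSpace ℝ (Fin (n + 2)) × ℝ) finrank_prod_eq).equivFun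

/-- The `ℝⁿ⁺³`-coordinates of `T_p W_U × ℝ` in the overlap chart. [folklore] -/
def Λ (p : X.P) : (EuclideanSpace ℝ (Fin (n + 2)) × ℝ) →ₗ[ℝ] (ιN n → ℝ) :=
  (vecEquiv n).toLinearMap ∘ₗ X.coordV p

/-- `Λ_p` is injective over the chart target. [folklore] -/
theorem injective_Λ {p : X.P} (hp : p ∈ X.Θ.target) : Function.Injective (X.Λ p) :=
  (vecEquiv n).injective.comp (X.injective_coordV hp)

/-- **The coordinate matrix of a frame field** in the overlap chart: column `i` is the coordinate
vector of the `i`-th frame vector. [cite: MilnorStasheff1974, §2] -/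
def Bmat (Fr : X.P → ιN n → EuclideanSpace ℝ (Fin (n + 2)) × ℝ) (p : X.P) : Matrix (ιN n) (ιN n) ℝ :=
  Matrix.of fun k i => X.Λ p (Fr p i) k

/-- Columns of the coordinate matrix. [folklore] -/
theorem Bmat_col (Fr : X.P → ιN n → EuclideanSpace ℝ (Fin (n + 2)) × ℝ) (p : X.P) (i : ιN n) :
    (X.Bmat Fr p).col i = X.Λ p (Fr p i) := by
  funext k
  rfl

/-- The coordinate matrix of a frame over the chart target is invertible. [folklore] -/
theorem isUnit_det_Bmat {Fr : X.P → ιN n → EuclideanSpace ℝ (Fin (n + 2)) × ℝ} {p : X.P}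
    (hp : p ∈ X.Θ.target) (hli : LinearIndependent ℝ (Fr p)) : IsUnit (X.Bmat Fr p).det := by
  rw [← Matrix.isUnit_iff_isUnit_det, ← Matrix.linearIndependent_cols_iff_isUnit]
  have h : (X.Bmat Fr p).col = (X.Λ p) ∘ Fr p := by
    funext i
    exact X.Bmat_col Fr p i
  rw [h]
  exact hli.map' _ (LinearMap.ker_eq_bot.2 (X.injective_Λ hp))

/-- **The coordinate matrix of a continuous frame field is continuous** on a region inside the
chart target: the chart coordinates `dΘ⁻¹_p (v p)` of a continuous vector field are continuous
(push-forward along the `C¹` map `Θ⁻¹`, then the triviality of `Tℍ`). [cite: MilnorStasheff1974, §2] -/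
theorem continuousOn_Bmat {Fr : X.P → ιN n → EuclideanSpace ℝ (Fin (n + 2)) × ℝ} {R : Set X.P}
    (hR : R ⊆ X.Θ.target)
    (hc : ∀ i, ContinuousOn (fun p => (TotalSpace.mk' (EuclideanSpace ℝ (Fin (n + 2))) p (Fr p i).1 :
      TangentBundle (𝓡∂ (n + 2)) X.P)) R)
    (hc2 : ∀ i, ContinuousOn (fun p => (Fr p i).2) R) : ContinuousOn (X.Bmat Fr) R := by
  have hL : ∀ i, ContinuousOn (fun p => X.Lmap p (Fr p i).1) R := by
    intro i
    have h := ContinuousOn.totalSpaceMk_mfderiv (I := 𝓡∂ (n + 2)) (J := 𝓡∂ (n + 2)) (f := X.Θ.symm)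
      X.Θ.open_target X.contMDiffOn_Θ_symm (g := fun p : X.P => p) (v := fun p => (Fr p i).1) (t := R)
      (hc i) hR
    exact continuousOn_snd_of_totalSpaceMk_modelSpace h
  refine continuousOn_pi.2 fun k => continuousOn_pi.2 fun i => ?_
  have hv : Continuous (vecEquiv n) := (vecEquiv n).toLinearMap.continuous_of_finiteDimensional
  have h := (continuous_apply k).comp_continuousOn (hv.comp_continuousOn ((hL i).prodMk (hc2 i)))
  exact h.congr fun p _ => rfl

/-- **The transition matrix** `g = (B²)⁻¹ B¹` of the two frame fields over the overlap.
[cite: MilnorStasheff1974, §3] -/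
def trans (p : X.P) : Matrix (ιN n) (ιN n) ℝ := (X.Bmat (X.frame₂ FT) p)⁻¹ * X.Bmat (X.frame₁ FS) p

/-- **Twisting by the transition matrix turns the second frame into the first**:
`Σⱼ gⱼᵢ F²ⱼ = F¹ᵢ` over the chart target. [cite: MilnorStasheff1974, §3] -/
theorem sum_trans_smul {p : X.P} (hp : p ∈ X.Θ.target) (i : ιN n) :
    ∑ j, X.trans FS FT p j i • X.frame₂ FT p j = X.frame₁ FS p i := by
  apply X.injective_Λ hp
  rw [map_sum]
  simp only [map_smul]
  funext k
  have hdet := X.isUnit_det_Bmat hp (X.linearIndependent_frame₂ FT p)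
  have hk : (X.Bmat (X.frame₂ FT) p * X.trans FS FT p) k i = X.Bmat (X.frame₁ FS) p k i := by
    rw [trans, Matrix.mul_nonsing_inv_cancel_left _ _ hdet]
  rw [Matrix.mul_apply] at hk
  have hk' : ∑ j, X.Λ p (X.frame₂ FT p j) k * X.trans FS FT p j i = X.Λ p (X.frame₁ FS p i) k := hk
  rw [Finset.sum_apply]
  simp only [Pi.smul_apply, smul_eq_mul]
  rw [← hk']
  exact Finset.sum_congr rfl fun j _ => mul_comm _ _

/-- The transition matrix is invertible over the chart target. [cite: MilnorStasheff1974, §3] -/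
theorem isUnit_det_trans {p : X.P} (hp : p ∈ X.Θ.target) : IsUnit (X.trans FS FT p).det := by
  rw [trans, Matrix.det_mul]
  exact (Matrix.isUnit_nonsing_inv_det_iff.2 (X.isUnit_det_Bmat hp (X.linearIndependent_frame₂ FT p))).mul
    (X.isUnit_det_Bmat hp (X.linearIndependent_frame₁ FS p))

end Frames

/-! ### The overlap read in the chart: radii -/

section Radii

/-- `Θ.symm (Θ v) = v` on the source. [folklore] -/
theorem Θ_left_inv {v : EuclideanHalfSpace (n + 2)} (hv : 0 < ‖v.val‖) : X.Θ.symm (X.Θ v) = v :=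
  X.Θ.left_inv (X.mem_Θ_source hv)

/-- Points of the source of the overlap chart have positive norm. [folklore] -/
theorem norm_pos_of_mem_Θ_source {v : EuclideanHalfSpace (n + 2)} (hv : v ∈ X.Θ.source) : 0 < ‖v.val‖ := by
  rw [mem_Θ_source_iff, mem_puncture] at hv
  refine norm_pos_iff.2 fun h => hv ?_
  have h0 : v = 0 := EuclideanHalfSpace.ext _ _ (by rw [h]; rfl)
  rw [h0]

/-- **Points of the chart target are `Θ v` with `v ≠ 0`.** [folklore] -/
theorem exists_eq_Θ_of_mem_target {p : X.P} (hp : p ∈ X.Θ.target) :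
    ∃ v : EuclideanHalfSpace (n + 2), 0 < ‖v.val‖ ∧ X.Θ v = p :=
  ⟨X.Θ.symm p, X.norm_pos_of_mem_Θ_source (X.Θ.map_target hp), X.Θ.right_inv hp⟩

/-- `Θ v` lies in the chart target for `v ≠ 0`. [folklore] -/
theorem Θ_mem_target {v : EuclideanHalfSpace (n + 2)} (hv : 0 < ‖v.val‖) : X.Θ v ∈ X.Θ.target :=
  X.Θ.map_source (X.mem_Θ_source hv)

/-- The chart target lies in the first piece `U₁ = range ι₁`. [folklore] -/
theorem Θ_target_subset_range : X.Θ.target ⊆ range X.W.ι₁ := fun p hp => by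
  obtain ⟨v, hv, rfl⟩ := X.exists_eq_Θ_of_mem_target hp
  rw [X.Θ_apply (X.kS_mem_puncture hv)]
  exact ⟨_, rfl⟩

/-- Chart points of norm `< 1` lie in the second piece `U₂ = range ι₂` (they are glued).
[cite: Juhasz2023, Def. 1.47] -/
theorem Θ_mem_range_ι₂ {v : EuclideanHalfSpace (n + 2)} (hv : 0 < ‖v.val‖) (hv1 : ‖v.val‖ < 1) :
    X.Θ v ∈ range X.W.ι₂ := by
  rw [X.Θ_apply (X.kS_mem_puncture hv)]
  exact X.ι₁_kS_mem_range_ι₂ hv hv1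

/-- **A point of the first piece which is glued is a chart point of norm `< 1`.**
[cite: Juhasz2023, Def. 1.47] -/
theorem exists_eq_Θ_of_mem_inter {p : X.P} (h1 : p ∈ range X.W.ι₁) (h2 : p ∈ range X.W.ι₂) :
    ∃ v : EuclideanHalfSpace (n + 2), 0 < ‖v.val‖ ∧ ‖v.val‖ < 1 ∧ X.Θ v = p := by
  obtain ⟨a, rfl⟩ := h1
  obtain ⟨v, hv0, hv1, hav⟩ := X.exists_eq_kS_of_mem_range a h2
  refine ⟨v, hv0, hv1, ?_⟩
  rw [X.Θ_apply (X.kS_mem_puncture hv0)]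
  congr 1
  exact Subtype.ext hav.symm

/-- **The norm in the overlap chart** `ν p = ‖Θ⁻¹ p‖`. [folklore] -/
def ν (p : X.P) : ℝ := ‖(X.Θ.symm p).val‖

/-- `ν (Θ v) = ‖v‖`. [folklore] -/
theorem ν_Θ {v : EuclideanHalfSpace (n + 2)} (hv : 0 < ‖v.val‖) : X.ν (X.Θ v) = ‖v.val‖ := by
  rw [ν, X.Θ_left_inv hv]

/-- `ν` is continuous on the chart target. [folklore] -/
theorem continuousOn_ν : ContinuousOn X.ν X.Θ.target :=
  (continuous_norm.comp continuous_subtype_val).comp_continuousOn X.Θ.continuousOn_symm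

/-- `ν` is positive on the chart target. [folklore] -/
theorem ν_pos {p : X.P} (hp : p ∈ X.Θ.target) : 0 < X.ν p :=
  X.norm_pos_of_mem_Θ_source (X.Θ.map_target hp)

/-- A glued point of the second piece in `T`-coordinates: `ι₂ (k_T v')` with `0 < ‖v'‖ < 1` is the
chart point `Θ v` with `‖v‖ = 1 - ‖v'‖`. [cite: Juhasz2023, Def. 1.47] -/
theorem exists_eq_Θ_of_ι₂_kT {v' : EuclideanHalfSpace (n + 2)} (hv0 : 0 < ‖v'.val‖) (hv1 : ‖v'.val‖ < 1) :
    ∃ v : EuclideanHalfSpace (n + 2), 0 < ‖v.val‖ ∧ ‖v.val‖ = 1 - ‖v'.val‖ ∧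
      X.Θ v = X.W.ι₂ ⟨X.kT v', X.kT_mem_puncture hv0⟩ := by
  -- `v' = dilate (1 - t) u`, `t = 1 - ‖v'‖`, `u` unit; the glued point is `ι₁ (k_S (dilate t u))`
  set t : ℝ := 1 - ‖v'.val‖ with ht
  have ht0 : 0 < t := by rw [ht]; linarith
  have ht1 : t < 1 := by rw [ht]; linarith
  let u : EuclideanHalfSpace (n + 2) := EuclideanHalfSpace.dilate ‖v'.val‖⁻¹ v'
  have hu : ‖u.val‖ = 1 := by
    change ‖(EuclideanHalfSpace.dilate ‖v'.val‖⁻¹ v').val‖ = 1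
    rw [EuclideanHalfSpace.val_dilate_of_nonneg (inv_nonneg.2 hv0.le), norm_smul,
      Real.norm_of_nonneg (inv_nonneg.2 hv0.le), inv_mul_cancel₀ hv0.ne']
  have hv'u : v' = EuclideanHalfSpace.dilate (1 - t) u := by
    change v' = EuclideanHalfSpace.dilate (1 - t) (EuclideanHalfSpace.dilate ‖v'.val‖⁻¹ v')
    rw [EuclideanHalfSpace.dilate_dilate (by linarith) (inv_nonneg.2 hv0.le), ht, sub_sub_cancel,
      mul_inv_cancel₀ hv0.ne', EuclideanHalfSpace.dilate_one]
  refine ⟨EuclideanHalfSpace.dilate t u, ?_, ?_, ?_⟩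
  · rw [EuclideanHalfSpace.norm_val_dilate ht0.le hu]; exact ht0
  · rw [EuclideanHalfSpace.norm_val_dilate ht0.le hu]
  · have h0 : 0 < ‖(EuclideanHalfSpace.dilate t u).val‖ := by
      rw [EuclideanHalfSpace.norm_val_dilate ht0.le hu]; exact ht0
    rw [X.Θ_apply (X.kS_mem_puncture h0)]
    refine (X.W.rel _ _).2 ⟨u, t, hu, ⟨ht0, ht1⟩, rfl, ?_⟩
    change X.kT v' = X.kT (EuclideanHalfSpace.dilate (1 - t) u)
    rw [← hv'u]

/-- A glued point of the second piece is `k_T v'` with `0 < ‖v'‖ < 1`.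
[cite: Juhasz2023, Def. 1.47] -/
theorem exists_eq_kT_of_mem_range (b : ↥(puncture X.kT)) (hb : X.W.ι₂ b ∈ range X.W.ι₁) :
    ∃ v' : EuclideanHalfSpace (n + 2), 0 < ‖v'.val‖ ∧ ‖v'.val‖ < 1 ∧ (b : X.cT.W) = X.kT v' := by
  obtain ⟨a, ha⟩ := hb
  obtain ⟨u, t, hu, ht, -, hbt⟩ := (X.W.rel a b).1 ha
  refine ⟨EuclideanHalfSpace.dilate (1 - t) u, ?_, ?_, hbt⟩
  · rw [EuclideanHalfSpace.norm_val_dilate (by linarith [ht.2]) hu]; linarith [ht.2]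
  · rw [EuclideanHalfSpace.norm_val_dilate (by linarith [ht.2]) hu]; linarith [ht.1]

/-! ### The closed cover `C₁ ∪ C₂ = W_U` on which the two frames are pasted -/

/-- The `S`-side closed piece `C(r) = U₁ ∖ Θ(‖v‖ < r)`. [cite: KervaireMilnorAnnals1963, §2 p. 508] -/
def Cset (r : ℝ) : Set X.P := {p | p ∈ range X.W.ι₁ ∧ (p ∈ X.Θ.target → r ≤ X.ν p)}

/-- The `T`-side closed piece `D(r) = (U₂ ∖ U₁) ∪ Θ(‖v‖ ≤ r)`. [cite: KervaireMilnorAnnals1963, §2 p. 508] -/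
def Dset (r : ℝ) : Set X.P := {p | p ∉ range X.W.ι₁ ∨ (p ∈ X.Θ.target ∧ X.ν p ≤ r)}

/-- The closed half space is closed in `ℝⁿ⁺²`; so `val : ℍ → ℝⁿ⁺²` is a closed embedding.
[folklore] -/
theorem isClosedEmbedding_halfSpace_val :
    IsClosedEmbedding (Subtype.val : EuclideanHalfSpace (n + 2) → EuclideanSpace ℝ (Fin (n + 2))) := by
  refine IsClosed.isClosedEmbedding_subtypeVal ?_
  have h : {x : EuclideanSpace ℝ (Fin (n + 2)) | 0 ≤ x 0} =
      (EuclideanSpace.proj (0 : Fin (n + 2))) ⁻¹' Ici (0 : ℝ) := by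
    ext x; rfl
  change IsClosed {x : EuclideanSpace ℝ (Fin (n + 2)) | 0 ≤ x 0}
  rw [h]
  exact isClosed_Ici.preimage (EuclideanSpace.proj (0 : Fin (n + 2))).continuous

/-- Closed balls of the half space are compact. [folklore] -/
theorem isCompact_halfSpace_closedBall (r : ℝ) :
    IsCompact {v : EuclideanHalfSpace (n + 2) | ‖v.val‖ ≤ r} := by
  have h : {v : EuclideanHalfSpace (n + 2) | ‖v.val‖ ≤ r} =
      Subtype.val ⁻¹' Metric.closedBall (0 : EuclideanSpace ℝ (Fin (n + 2))) r := by
    ext v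
    change ‖v.val‖ ≤ r ↔ v.val ∈ Metric.closedBall (0 : EuclideanSpace ℝ (Fin (n + 2))) r
    rw [Metric.mem_closedBall, dist_zero_right]
  rw [h]
  exact isClosedEmbedding_halfSpace_val.isCompact_preimage (isCompact_closedBall _ _)

/-- The image `k_S(‖v‖ ≤ r)` is closed in `W_S`. [folklore] -/
theorem isClosed_kS_image (r : ℝ) : IsClosed (X.kS '' {v : EuclideanHalfSpace (n + 2) | ‖v.val‖ ≤ r}) :=
  ((isCompact_halfSpace_closedBall r).image X.isSmoothEmbedding_kS.1.isEmbedding.continuous).isClosed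

/-- The image `k_T(‖v‖ ≤ r)` is closed in `W_T`. [folklore] -/
theorem isClosed_kT_image (r : ℝ) : IsClosed (X.kT '' {v : EuclideanHalfSpace (n + 2) | ‖v.val‖ ≤ r}) :=
  ((isCompact_halfSpace_closedBall r).image X.isSmoothEmbedding_kT.1.isEmbedding.continuous).isClosed

/-- **Chart description of `ι₁ a`**: `ι₁ a ∈ Θ.target` with `ν (ι₁ a) ≤ r` iff `a ∈ k_S(‖v‖ ≤ r)`.
[folklore] -/
theorem ι₁_mem_target_and_ν_le_iff (a : ↥(puncture X.kS)) (r : ℝ) :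
    (X.W.ι₁ a ∈ X.Θ.target ∧ X.ν (X.W.ι₁ a) ≤ r) ↔
      (a : X.cS.W) ∈ X.kS '' {v : EuclideanHalfSpace (n + 2) | ‖v.val‖ ≤ r} := by
  constructor
  · rintro ⟨ht, hν⟩
    obtain ⟨v, hv0, hv⟩ := X.exists_eq_Θ_of_mem_target ht
    have hν' : X.ν (X.Θ v) ≤ r := by rw [hv]; exact hν
    rw [X.ν_Θ hv0] at hν'
    rw [X.Θ_apply (X.kS_mem_puncture hv0)] at hv
    have ha : a = ⟨X.kS v, X.kS_mem_puncture hv0⟩ := (X.W.ι₁_injective hv).symm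
    exact ⟨v, hν', by rw [ha]⟩
  · rintro ⟨v, hvr, hva⟩
    have hv0 : 0 < ‖v.val‖ := by
      refine norm_pos_iff.2 fun h => a.2 ?_
      have h0 : v = 0 := EuclideanHalfSpace.ext _ _ (by rw [h]; rfl)
      rw [mem_singleton_iff, ← hva, h0]
    have ha : a = ⟨X.kS v, X.kS_mem_puncture hv0⟩ := Subtype.ext hva.symm
    rw [ha, ← X.Θ_apply (X.kS_mem_puncture hv0)]
    exact ⟨X.Θ_mem_target hv0, by rw [X.ν_Θ hv0]; exact hvr⟩

/-- The complement of `D(r)` is `ι₁` of the points of the first piece off `k_S(‖v‖ ≤ r)`.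
[folklore] -/
theorem compl_Dset_eq (r : ℝ) :
    (X.Dset r)ᶜ = X.W.ι₁ '' {a | (a : X.cS.W) ∉ X.kS '' {v : EuclideanHalfSpace (n + 2) | ‖v.val‖ ≤ r}} := by
  ext p
  simp only [Dset, mem_compl_iff, mem_setOf_eq, not_or, not_and, not_le, mem_image]
  constructor
  · rintro ⟨h1, h2⟩
    obtain ⟨a, rfl⟩ := not_not.1 h1
    refine ⟨a, fun ha => ?_, rfl⟩
    obtain ⟨ht, hν⟩ := (X.ι₁_mem_target_and_ν_le_iff a r).2 ha
    exact lt_irrefl _ ((h2 ht).trans_le hν)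
  · rintro ⟨a, ha, rfl⟩
    refine ⟨not_not.2 ⟨a, rfl⟩, fun ht => ?_⟩
    by_contra hν
    exact ha ((X.ι₁_mem_target_and_ν_le_iff a r).1 ⟨ht, not_lt.1 hν⟩)

/-- `ι₁` is an open embedding. [folklore] -/
theorem isOpenEmbedding_ι₁ : IsOpenEmbedding X.W.ι₁ := ⟨X.W.h₁.isEmbedding, X.W.h₁o⟩

/-- `ι₂` is an open embedding. [folklore] -/
theorem isOpenEmbedding_ι₂ : IsOpenEmbedding X.W.ι₂ := ⟨X.W.h₂.isEmbedding, X.W.h₂o⟩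

/-- **`D(r)` is closed.** [folklore] -/
theorem isClosed_Dset (r : ℝ) : IsClosed (X.Dset r) := by
  rw [← isOpen_compl_iff, X.compl_Dset_eq r]
  exact X.isOpenEmbedding_ι₁.isOpenMap _
    ((X.isClosed_kS_image r).isOpen_compl.preimage continuous_subtype_val)

/-- The complement of `C(r)`, `0 < r < 1`, is `ι₂` of the points of the second piece off
`k_T(‖v'‖ ≤ 1 - r)`. [cite: Juhasz2023, Def. 1.47] -/
theorem compl_Cset_eq {r : ℝ} (hr0 : 0 < r) (hr1 : r < 1) :
    (X.Cset r)ᶜ = X.W.ι₂ '' {b | (b : X.cT.W) ∉ X.kT '' {v : EuclideanHalfSpace (n + 2) | ‖v.val‖ ≤ 1 - r}} := by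
  ext p
  simp only [Cset, mem_compl_iff, mem_setOf_eq, not_and, not_forall, not_le, mem_image, exists_prop]
  constructor
  · intro h
    by_cases h1 : p ∈ range X.W.ι₁
    · -- `p` is a chart point of norm `< r`, glued to `ι₂ (k_T v')` with `‖v'‖ = 1 - ν p > 1 - r`
      obtain ⟨ht, hν⟩ := h h1
      obtain ⟨v, hv0, rfl⟩ := X.exists_eq_Θ_of_mem_target ht
      rw [X.ν_Θ hv0] at hν
      obtain ⟨b, hb⟩ := X.Θ_mem_range_ι₂ hv0 (hν.trans hr1)
      refine ⟨b, ?_, hb⟩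
      rintro ⟨v'', hv''r, hv''b⟩
      have hv''0 : 0 < ‖v''.val‖ := by
        refine norm_pos_iff.2 fun h0 => b.2 ?_
        have h00 : v'' = 0 := EuclideanHalfSpace.ext _ _ (by rw [h0]; rfl)
        rw [mem_singleton_iff, ← hv''b, h00]
      have hv''1 : ‖v''.val‖ < 1 := by
        change ‖v''.val‖ ≤ 1 - r at hv''r
        linarith
      obtain ⟨w, hw0, hw, hwb⟩ := X.exists_eq_Θ_of_ι₂_kT hv''0 hv''1
      have hb' : b = ⟨X.kT v'', X.kT_mem_puncture hv''0⟩ := Subtype.ext hv''b.symm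
      rw [← hb', hb] at hwb
      have hwv : w = v := by
        have := X.Θ.injOn (X.mem_Θ_source hw0) (X.mem_Θ_source hv0) hwb
        exact this
      rw [hwv] at hw
      change ‖v''.val‖ ≤ 1 - r at hv''r
      linarith
    · -- `p` is not glued: `p = ι₂ b` with `b` off the open unit half-disc
      have h2 : p ∈ range X.W.ι₂ := by
        have := X.W.cover ▸ mem_univ p
        exact this.resolve_left h1
      obtain ⟨b, rfl⟩ := h2
      refine ⟨b, ?_, rfl⟩
      rintro ⟨v', hv'r, hv'b⟩
      have hv'0 : 0 < ‖v'.val‖ := by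
        refine norm_pos_iff.2 fun h0 => b.2 ?_
        have h00 : v' = 0 := EuclideanHalfSpace.ext _ _ (by rw [h0]; rfl)
        rw [mem_singleton_iff, ← hv'b, h00]
      have hv'1 : ‖v'.val‖ < 1 := by
        change ‖v'.val‖ ≤ 1 - r at hv'r
        linarith
      obtain ⟨w, hw0, -, hwb⟩ := X.exists_eq_Θ_of_ι₂_kT hv'0 hv'1
      have hb' : b = ⟨X.kT v', X.kT_mem_puncture hv'0⟩ := Subtype.ext hv'b.symm
      rw [← hb'] at hwb
      exact h1 (hwb ▸ X.Θ_target_subset_range (X.Θ_mem_target hw0))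
  · rintro ⟨b, hb, rfl⟩ h1
    obtain ⟨v', hv'0, hv'1, hbv'⟩ := X.exists_eq_kT_of_mem_range b h1
    have hgt : 1 - r < ‖v'.val‖ := by
      by_contra hle
      exact hb ⟨v', not_lt.1 hle, hbv'.symm⟩
    obtain ⟨w, hw0, hw, hwb⟩ := X.exists_eq_Θ_of_ι₂_kT hv'0 hv'1
    have hb' : b = ⟨X.kT v', X.kT_mem_puncture hv'0⟩ := Subtype.ext hbv'
    rw [← hb'] at hwb
    refine ⟨hwb ▸ X.Θ_mem_target hw0, ?_⟩
    rw [← hwb, X.ν_Θ hw0, hw]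
    linarith

/-- **`C(r)` is closed** for `0 < r < 1`. [folklore] -/
theorem isClosed_Cset {r : ℝ} (hr0 : 0 < r) (hr1 : r < 1) : IsClosed (X.Cset r) := by
  rw [← isOpen_compl_iff, X.compl_Cset_eq hr0 hr1]
  exact X.isOpenEmbedding_ι₂.isOpenMap _
    ((X.isClosed_kT_image (1 - r)).isOpen_compl.preimage continuous_subtype_val)

/-- `C(r) ∪ D(r) = W_U`. [folklore] -/
theorem Cset_union_Dset (r : ℝ) : X.Cset r ∪ X.Dset r = univ := by
  refine eq_univ_of_forall fun p => ?_
  by_cases h1 : p ∈ range X.W.ι₁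
  · by_cases h2 : p ∈ X.Θ.target ∧ X.ν p < r
    · exact Or.inr (Or.inr ⟨h2.1, h2.2.le⟩)
    · exact Or.inl ⟨h1, fun ht => not_lt.1 fun hlt => h2 ⟨ht, hlt⟩⟩
  · exact Or.inr (Or.inl h1)

/-- Points of `C(r) ∩ D(r)` are chart points of chart-norm exactly `r`. [folklore] -/
theorem mem_target_and_ν_eq_of_mem_inter {r : ℝ} {p : X.P} (hp : p ∈ X.Cset r ∩ X.Dset r) :
    p ∈ X.Θ.target ∧ X.ν p = r := by
  obtain ⟨⟨h1, hC⟩, hD⟩ := hp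
  rcases hD with hD | ⟨ht, hν⟩
  · exact absurd h1 hD
  · exact ⟨ht, le_antisymm hν (hC ht)⟩

/-- `D(r₁) ⊆ U₂` for `r₁ < 1`. [folklore] -/
theorem Dset_subset_range_ι₂ {r : ℝ} (hr1 : r < 1) : X.Dset r ⊆ range X.W.ι₂ := by
  rintro p (h | ⟨ht, hν⟩)
  · exact (X.W.cover ▸ mem_univ p : p ∈ range X.W.ι₁ ∪ range X.W.ι₂).resolve_left h
  · obtain ⟨v, hv0, rfl⟩ := X.exists_eq_Θ_of_mem_target ht
    rw [X.ν_Θ hv0] at hν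
    exact X.Θ_mem_range_ι₂ hv0 (hν.trans_lt hr1)

/-- `C(r) ⊆ U₁`. [folklore] -/
theorem Cset_subset_range_ι₁ (r : ℝ) : X.Cset r ⊆ range X.W.ι₁ := fun _ hp => hp.1

/-- The chart shell `E(r₀, r₁) = Θ(r₀ ≤ ‖v‖ ≤ r₁)`. [folklore] -/
def Eset (r₀ r₁ : ℝ) : Set X.P := {p | p ∈ X.Θ.target ∧ r₀ ≤ X.ν p ∧ X.ν p ≤ r₁}

/-- The chart shell is the `Θ`-image of the compact shell of the half space. [folklore] -/
theorem Eset_eq_image {r₀ : ℝ} (hr₀ : 0 < r₀) (r₁ : ℝ) :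
    X.Eset r₀ r₁ = X.Θ '' {v : EuclideanHalfSpace (n + 2) | r₀ ≤ ‖v.val‖ ∧ ‖v.val‖ ≤ r₁} := by
  ext p
  constructor
  · rintro ⟨ht, h0, h1⟩
    obtain ⟨v, hv0, rfl⟩ := X.exists_eq_Θ_of_mem_target ht
    rw [X.ν_Θ hv0] at h0 h1
    exact ⟨v, ⟨h0, h1⟩, rfl⟩
  · rintro ⟨v, ⟨h0, h1⟩, rfl⟩
    have hv0 : 0 < ‖v.val‖ := hr₀.trans_le h0
    exact ⟨X.Θ_mem_target hv0, by rw [X.ν_Θ hv0]; exact h0, by rw [X.ν_Θ hv0]; exact h1⟩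

/-- **The chart shell is closed** (compact). [folklore] -/
theorem isClosed_Eset {r₀ : ℝ} (hr₀ : 0 < r₀) (r₁ : ℝ) : IsClosed (X.Eset r₀ r₁) := by
  rw [X.Eset_eq_image hr₀ r₁]
  refine (IsCompact.image_of_continuousOn ?_ (X.Θ.continuousOn.mono fun v hv => ?_)).isClosed
  · exact (isCompact_halfSpace_closedBall r₁).of_isClosed_subset
      (isClosed_le continuous_const (continuous_norm.comp continuous_subtype_val) |>.inter
        (isClosed_le (continuous_norm.comp continuous_subtype_val) continuous_const))
      fun v hv => hv.2
  · exact X.mem_Θ_source (hr₀.trans_le hv.1)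

/-- `D(r₁) = D(r₀) ∪ E(r₀, r₁)` for `r₀ ≤ r₁`. [folklore] -/
theorem Dset_eq_union {r₀ r₁ : ℝ} (h : r₀ ≤ r₁) : X.Dset r₁ = X.Dset r₀ ∪ X.Eset r₀ r₁ := by
  ext p
  simp only [Dset, Eset, mem_union, mem_setOf_eq]
  constructor
  · rintro (h1 | ⟨ht, hν⟩)
    · exact Or.inl (Or.inl h1)
    · by_cases h0 : X.ν p ≤ r₀
      · exact Or.inl (Or.inr ⟨ht, h0⟩)
      · exact Or.inr ⟨ht, (not_le.1 h0).le, hν⟩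
  · rintro ((h1 | ⟨ht, hν⟩) | ⟨ht, -, hν⟩)
    · exact Or.inl h1
    · exact Or.inr ⟨ht, hν.trans h⟩
    · exact Or.inr ⟨ht, hν⟩

end Radii

/-! ### The radial contraction of the chart shell onto one point of the seam sphere -/

section Contraction

/-- The pole `e₀ = (1, 0, …, 0)` of the half space. [folklore] -/
def e₀ (n : ℕ) : EuclideanSpace ℝ (Fin (n + 2)) := EuclideanSpace.single (0 : Fin (n + 2)) (1 : ℝ)

/-- `‖e₀‖ = 1`. [folklore] -/
theorem norm_e₀ : ‖e₀ n‖ = 1 := by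
  rw [e₀, PiLp.norm_single, norm_one]

/-- `e₀ 0 = 1`. [folklore] -/
theorem e₀_apply_zero : e₀ n 0 = 1 := by
  rw [e₀, PiLp.single_apply, if_pos rfl]

/-- The interpolation parameter `λ(v) ∈ [0, 1]`: `0` on `‖v‖ ≥ 1/2`, `1` on `‖v‖ ≤ 1/4`, affine in
between. [folklore] -/
def lam (v : EuclideanHalfSpace (n + 2)) : ℝ := min 1 (max 0 (4 * (1 / 2 - ‖v.val‖)))

/-- `0 ≤ λ`. [folklore] -/
theorem lam_nonneg (v : EuclideanHalfSpace (n + 2)) : 0 ≤ lam v :=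
  le_min zero_le_one (le_max_left _ _)

/-- `λ ≤ 1`. [folklore] -/
theorem lam_le_one (v : EuclideanHalfSpace (n + 2)) : lam v ≤ 1 := min_le_left _ _

/-- `λ = 0` on the seam sphere `‖v‖ = 1/2`. [folklore] -/
theorem lam_eq_zero {v : EuclideanHalfSpace (n + 2)} (hv : ‖v.val‖ = 1 / 2) : lam v = 0 := by
  rw [lam, hv, sub_self, mul_zero, max_self, min_eq_right zero_le_one]

/-- `λ = 1` on `‖v‖ ≤ 1/4`. [folklore] -/
theorem lam_eq_one {v : EuclideanHalfSpace (n + 2)} (hv : ‖v.val‖ ≤ 1 / 4) : lam v = 1 := by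
  rw [lam]
  refine min_eq_left (le_max_of_le_right ?_)
  linarith

/-- `λ` is continuous. [folklore] -/
theorem continuous_lam : Continuous (lam (n := n)) :=
  continuous_const.min (continuous_const.max
    (continuous_const.mul (continuous_const.sub (continuous_norm.comp continuous_subtype_val))))

/-- The un-normalised contraction `u(v) = (1 - λ) v/‖v‖ + λ e₀`. [folklore] -/
def uvec (v : EuclideanHalfSpace (n + 2)) : EuclideanSpace ℝ (Fin (n + 2)) :=
  (1 - lam v) • (‖v.val‖⁻¹ • v.val) + lam v • e₀ n

/-- The height of `u(v)` is at least `λ(v)`. [folklore] -/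
theorem lam_le_uvec_apply_zero (v : EuclideanHalfSpace (n + 2)) : lam v ≤ uvec v 0 := by
  have h1 : 0 ≤ (1 - lam v) * (‖v.val‖⁻¹ * v.val 0) :=
    mul_nonneg (sub_nonneg.2 (lam_le_one v)) (mul_nonneg (inv_nonneg.2 (norm_nonneg _)) v.2)
  have h2 : uvec v 0 = (1 - lam v) * (‖v.val‖⁻¹ * v.val 0) + lam v * e₀ n 0 := rfl
  rw [h2, e₀_apply_zero, mul_one]
  linarith

/-- `u(v)` lies in the closed half space. [folklore] -/
theorem uvec_apply_zero_nonneg (v : EuclideanHalfSpace (n + 2)) : 0 ≤ uvec v 0 :=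
  (lam_nonneg v).trans (lam_le_uvec_apply_zero v)

/-- `u(v) ≠ 0` for `v ≠ 0`. [folklore] -/
theorem uvec_ne_zero {v : EuclideanHalfSpace (n + 2)} (hv : 0 < ‖v.val‖) : uvec v ≠ 0 := by
  intro h
  have h0 : uvec v 0 = 0 := by rw [h]; rfl
  have hl : lam v = 0 := le_antisymm (h0 ▸ lam_le_uvec_apply_zero v) (lam_nonneg v)
  have hu : uvec v = ‖v.val‖⁻¹ • v.val := by
    rw [uvec, hl, sub_zero, one_smul, zero_smul, add_zero]
  rw [hu] at h
  rcases smul_eq_zero.1 h with h | h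
  · exact hv.ne' (inv_eq_zero.1 h)
  · rw [h, norm_zero] at hv
    exact lt_irrefl _ hv

/-- `u` is continuous off the origin. [folklore] -/
theorem continuousOn_uvec : ContinuousOn (uvec (n := n)) {v | 0 < ‖v.val‖} := by
  have h1 : ContinuousOn (fun v : EuclideanHalfSpace (n + 2) => ‖v.val‖⁻¹) {v | 0 < ‖v.val‖} :=
    (continuous_norm.comp continuous_subtype_val).continuousOn.inv₀ fun v hv => hv.ne'
  have h2 : ContinuousOn (fun v : EuclideanHalfSpace (n + 2) => (1 - lam v) • (‖v.val‖⁻¹ • v.val))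
      {v | 0 < ‖v.val‖} :=
    (continuous_const.sub continuous_lam).continuousOn.smul (h1.smul continuous_subtype_val.continuousOn)
  have h3 : ContinuousOn (fun v : EuclideanHalfSpace (n + 2) => lam v • e₀ n) {v | 0 < ‖v.val‖} :=
    continuous_lam.continuousOn.smul continuousOn_const
  exact h2.add h3

/-- **The contraction `c(v) = ½ u(v)/‖u(v)‖`** of the punctured half space onto the seam sphere
`‖v‖ = 1/2`, interpolating between the radial projection (on the sphere, the identity) and the
constant `½ e₀` (on `‖v‖ ≤ 1/4`). [folklore] -/
def cvec (v : EuclideanHalfSpace (n + 2)) : EuclideanHalfSpace (n + 2) :=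
  ⟨(1 / 2 : ℝ) • (‖uvec v‖⁻¹ • uvec v), by
    change 0 ≤ (1 / 2 : ℝ) * (‖uvec v‖⁻¹ * uvec v 0)
    exact mul_nonneg (by norm_num) (mul_nonneg (inv_nonneg.2 (norm_nonneg _)) (uvec_apply_zero_nonneg v))⟩

/-- `‖c(v)‖ = 1/2` for `v ≠ 0`. [folklore] -/
theorem norm_cvec {v : EuclideanHalfSpace (n + 2)} (hv : 0 < ‖v.val‖) : ‖(cvec v).val‖ = 1 / 2 := by
  change ‖(1 / 2 : ℝ) • (‖uvec v‖⁻¹ • uvec v)‖ = 1 / 2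
  rw [norm_smul, norm_smul, norm_inv, norm_norm, inv_mul_cancel₀ (norm_ne_zero_iff.2 (uvec_ne_zero hv)),
    mul_one, Real.norm_of_nonneg (by norm_num)]

/-- `c(v)` has positive norm. [folklore] -/
theorem norm_cvec_pos {v : EuclideanHalfSpace (n + 2)} (hv : 0 < ‖v.val‖) : 0 < ‖(cvec v).val‖ := by
  rw [norm_cvec hv]; norm_num

/-- **The contraction fixes the seam sphere.** [folklore] -/
theorem cvec_eq_self {v : EuclideanHalfSpace (n + 2)} (hv : ‖v.val‖ = 1 / 2) : cvec v = v := by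
  have hv0 : 0 < ‖v.val‖ := by rw [hv]; norm_num
  have hu : uvec v = ‖v.val‖⁻¹ • v.val := by
    rw [uvec, lam_eq_zero hv, sub_zero, one_smul, zero_smul, add_zero]
  apply EuclideanHalfSpace.ext
  change (1 / 2 : ℝ) • (‖uvec v‖⁻¹ • uvec v) = v.val
  rw [hu, norm_smul, norm_inv, norm_norm, inv_mul_cancel₀ hv0.ne', inv_one, one_smul, hv, smul_smul]
  norm_num

/-- The constant value `½ e₀` of the contraction, as a point of the half space. [folklore] -/
def c₀ (n : ℕ) : EuclideanHalfSpace (n + 2) :=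
  ⟨(1 / 2 : ℝ) • e₀ n, by
    change 0 ≤ (1 / 2 : ℝ) * e₀ n 0
    rw [e₀_apply_zero]; norm_num⟩

/-- `‖c₀‖ = 1/2`. [folklore] -/
theorem norm_c₀ : ‖(c₀ n).val‖ = 1 / 2 := by
  change ‖(1 / 2 : ℝ) • e₀ n‖ = 1 / 2
  rw [norm_smul, norm_e₀, mul_one, Real.norm_of_nonneg (by norm_num)]

/-- **The contraction is constant `½ e₀` on `‖v‖ ≤ 1/4`.** [folklore] -/
theorem cvec_eq_c₀ {v : EuclideanHalfSpace (n + 2)} (hv : ‖v.val‖ ≤ 1 / 4) : cvec v = c₀ n := by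
  have hu : uvec v = e₀ n := by
    rw [uvec, lam_eq_one hv, sub_self, zero_smul, zero_add, one_smul]
  apply EuclideanHalfSpace.ext
  change (1 / 2 : ℝ) • (‖uvec v‖⁻¹ • uvec v) = (1 / 2 : ℝ) • e₀ n
  rw [hu, norm_e₀, inv_one, one_smul]

/-- The contraction is continuous off the origin. [folklore] -/
theorem continuousOn_cvec : ContinuousOn (cvec (n := n)) {v | 0 < ‖v.val‖} := by
  have h1 : ContinuousOn (fun v : EuclideanHalfSpace (n + 2) => ‖uvec v‖⁻¹) {v | 0 < ‖v.val‖} :=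
    (continuous_norm.comp_continuousOn continuousOn_uvec).inv₀ fun v hv => norm_ne_zero_iff.2 (uvec_ne_zero hv)
  have h : ContinuousOn (fun v : EuclideanHalfSpace (n + 2) => (1 / 2 : ℝ) • (‖uvec v‖⁻¹ • uvec v))
      {v | 0 < ‖v.val‖} :=
    (h1.smul continuousOn_uvec).const_smul (1 / 2 : ℝ)
  exact IsInducing.subtypeVal.continuousOn_iff.2 h

end Contraction

/-! ### Twisting frames by invertible matrix fields -/

section Twist

variable {V : Type*} [AddCommGroup V] [Module ℝ V]

/-- **Twisting a frame by an invertible matrix gives a frame**: if `(uⱼ)` is linearly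
independent and `G` is invertible then so is `(Σⱼ Gⱼᵢ uⱼ)ᵢ`. [folklore] -/
theorem linearIndependent_twist {u : ιN n → V} (hu : LinearIndependent ℝ u)
    {G : Matrix (ιN n) (ιN n) ℝ} (hG : IsUnit G.det) :
    LinearIndependent ℝ fun i => ∑ j, G j i • u j := by
  rw [Fintype.linearIndependent_iff]
  intro c hc
  have hu' := Fintype.linearIndependent_iff.1 hu
  -- `Σᵢ cᵢ Σⱼ Gⱼᵢ uⱼ = Σⱼ (G c)ⱼ uⱼ`
  have h1 : ∑ i, c i • ∑ j, G j i • u j = ∑ j, (G.mulVec c) j • u j := by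
    simp only [Finset.smul_sum, smul_smul]
    rw [Finset.sum_comm]
    refine Finset.sum_congr rfl fun j _ => ?_
    rw [← Finset.sum_smul]
    congr 1
    simp only [Matrix.mulVec, dotProduct, mul_comm]
  rw [h1] at hc
  have h2 : G.mulVec c = 0 := funext fun j => hu' _ hc j
  have h3 : Function.Injective G.mulVec :=
    Matrix.mulVec_injective_iff_isUnit.2 ((Matrix.isUnit_iff_isUnit_det G).2 hG)
  have h4 : c = 0 := h3 (by rw [h2, Matrix.mulVec_zero])
  exact fun i => congrFun h4 i

end Twist

/-! ### The glued stable frame field -/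

section Glue

variable (FS : StableFrame (n := n) X.cS.W) (FT : StableFrame (n := n) X.cT.W)

/-- The region `R = Θ(0 < ‖v‖ < 1)` of the overlap where both frames are defined. [folklore] -/
def Rset : Set X.P := {p | p ∈ X.Θ.target ∧ X.ν p < 1}

/-- `R ⊆ Θ.target`. [folklore] -/
theorem Rset_subset_target : X.Rset ⊆ X.Θ.target := fun _ hp => hp.1

/-- `R ⊆ U₁`. [folklore] -/
theorem Rset_subset_range_ι₁ : X.Rset ⊆ range X.W.ι₁ := fun _ hp => X.Θ_target_subset_range hp.1

/-- `R ⊆ U₂`. [folklore] -/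
theorem Rset_subset_range_ι₂ : X.Rset ⊆ range X.W.ι₂ := fun p hp => by
  obtain ⟨v, hv0, rfl⟩ := X.exists_eq_Θ_of_mem_target hp.1
  have h1 := hp.2
  rw [X.ν_Θ hv0] at h1
  exact X.Θ_mem_range_ι₂ hv0 h1

/-- The coordinate matrix of the first frame is continuous on `R`. [cite: MilnorStasheff1974, §2] -/
theorem continuousOn_Bmat_frame₁ : ContinuousOn (X.Bmat (X.frame₁ FS)) X.Rset :=
  X.continuousOn_Bmat X.Rset_subset_target
    (fun i => (X.continuousOn_frame₁ FS i).mono X.Rset_subset_range_ι₁)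
    (fun i => (X.continuousOn_frame₁_snd FS i).mono X.Rset_subset_range_ι₁)

/-- The coordinate matrix of the second frame is continuous on `R`. [cite: MilnorStasheff1974, §2] -/
theorem continuousOn_Bmat_frame₂ : ContinuousOn (X.Bmat (X.frame₂ FT)) X.Rset :=
  X.continuousOn_Bmat X.Rset_subset_target
    (fun i => (X.continuousOn_frame₂ FT i).mono X.Rset_subset_range_ι₂)
    (fun i => (X.continuousOn_frame₂_snd FT i).mono X.Rset_subset_range_ι₂)

/-- **The transition matrix is continuous on the overlap region** (matrix inversion is continuous
at invertible matrices). [cite: MilnorStasheff1974, §3] -/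
theorem continuousOn_trans : ContinuousOn (X.trans FS FT) X.Rset := by
  have hinv : ContinuousOn (fun p => (X.Bmat (X.frame₂ FT) p)⁻¹) X.Rset := by
    intro p hp
    have hu := X.isUnit_det_Bmat hp.1 (X.linearIndependent_frame₂ FT p)
    have hc : ContinuousAt Ring.inverse (X.Bmat (X.frame₂ FT) p).det := by
      rw [Ring.inverse_eq_inv']
      exact continuousAt_inv₀ hu.ne_zero
    exact (continuousAt_matrix_inv _ hc).comp_continuousWithinAt (X.continuousOn_Bmat_frame₂ FT p hp)
  exact hinv.mul (X.continuousOn_Bmat_frame₁ FS)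

open Classical in
/-- **The twisting matrix field** on `W_U`: on the chart target, the transition matrix at the
contracted point `Θ (c (Θ⁻¹ p))` of the seam sphere; elsewhere the constant `g₀ = g(Θ c₀)`.
[cite: KervaireMilnorAnnals1963, §2 p. 508] -/
def Gfun (p : X.P) : Matrix (ιN n) (ιN n) ℝ :=
  if p ∈ X.Θ.target then X.trans FS FT (X.Θ (cvec (X.Θ.symm p))) else X.trans FS FT (X.Θ (c₀ n))

/-- The contracted point is in the overlap region. [folklore] -/
theorem Θ_cvec_mem_Rset {p : X.P} (hp : p ∈ X.Θ.target) : X.Θ (cvec (X.Θ.symm p)) ∈ X.Rset := by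
  have h0 := X.norm_pos_of_mem_Θ_source (X.Θ.map_target hp)
  refine ⟨X.Θ_mem_target (norm_cvec_pos h0), ?_⟩
  rw [X.ν_Θ (norm_cvec_pos h0), norm_cvec h0]
  norm_num

/-- `Θ c₀` is in the overlap region. [folklore] -/
theorem Θ_c₀_mem_Rset : X.Θ (c₀ n) ∈ X.Rset := by
  have h0 : 0 < ‖(c₀ n).val‖ := by rw [norm_c₀]; norm_num
  refine ⟨X.Θ_mem_target h0, ?_⟩
  rw [X.ν_Θ h0, norm_c₀]
  norm_num

/-- The twisting matrix is invertible everywhere. [cite: MilnorStasheff1974, §3] -/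
theorem isUnit_det_Gfun (p : X.P) : IsUnit (X.Gfun FS FT p).det := by
  unfold Gfun
  split_ifs with hp
  · exact X.isUnit_det_trans FS FT (X.Θ_cvec_mem_Rset hp).1
  · exact X.isUnit_det_trans FS FT X.Θ_c₀_mem_Rset.1

/-- On `D(1/4)` the twisting matrix is the constant `g₀`. [folklore] -/
theorem Gfun_of_mem_Dset {p : X.P} (hp : p ∈ X.Dset (1 / 4)) : X.Gfun FS FT p = X.trans FS FT (X.Θ (c₀ n)) := by
  unfold Gfun
  rcases hp with hp | ⟨ht, hν⟩
  · rw [if_neg fun ht => hp (X.Θ_target_subset_range ht)]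
  · rw [if_pos ht, cvec_eq_c₀ hν]

/-- The twisting matrix is continuous on the chart shell `E(1/4, 1/2)`. [cite: MilnorStasheff1974, §3] -/
theorem continuousOn_Gfun_Eset : ContinuousOn (X.Gfun FS FT) (X.Eset (1 / 4) (1 / 2)) := by
  have hE : X.Eset (1 / 4) (1 / 2) ⊆ X.Θ.target := fun p hp => hp.1
  have h : ContinuousOn (fun p => X.trans FS FT (X.Θ (cvec (X.Θ.symm p)))) (X.Eset (1 / 4) (1 / 2)) := by
    refine (X.continuousOn_trans FS FT).comp ?_ fun p hp => X.Θ_cvec_mem_Rset (hE hp)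
    refine X.Θ.continuousOn.comp ?_ fun p hp =>
      X.mem_Θ_source (norm_cvec_pos (X.norm_pos_of_mem_Θ_source (X.Θ.map_target (hE hp))))
    exact continuousOn_cvec.comp (X.Θ.continuousOn_symm.mono hE) fun p hp =>
      X.norm_pos_of_mem_Θ_source (X.Θ.map_target (hE hp))
  refine h.congr fun p hp => ?_
  unfold Gfun
  rw [if_pos (hE hp)]

/-- **The twisting matrix is continuous on `D(1/2)`** (constant on `D(1/4)`, continuous on the
shell, pasted along closed sets). [cite: MilnorStasheff1974, §3] -/
theorem continuousOn_Gfun_Dset : ContinuousOn (X.Gfun FS FT) (X.Dset (1 / 2)) := by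
  rw [X.Dset_eq_union (show (1 / 4 : ℝ) ≤ 1 / 2 by norm_num)]
  refine ContinuousOn.union_of_isClosed ?_ (X.continuousOn_Gfun_Eset FS FT) (X.isClosed_Dset _)
    (X.isClosed_Eset (by norm_num) _)
  exact continuousOn_const.congr fun p hp => X.Gfun_of_mem_Dset FS FT hp

/-- **The twisted second frame** `F̃²ᵢ = Σⱼ Gⱼᵢ F²ⱼ`. [cite: KervaireMilnorAnnals1963, §2 p. 508] -/
def frame₂' (p : X.P) (i : ιN n) : EuclideanSpace ℝ (Fin (n + 2)) × ℝ :=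
  ∑ j, X.Gfun FS FT p j i • X.frame₂ FT p j

/-- The twisted frame is a frame everywhere. [folklore] -/
theorem linearIndependent_frame₂' (p : X.P) : LinearIndependent ℝ (X.frame₂' FS FT p) :=
  linearIndependent_twist (X.linearIndependent_frame₂ FT p) (X.isUnit_det_Gfun FS FT p)

/-- `D(1/2) ⊆ U₂`. [folklore] -/
theorem Dset_half_subset : X.Dset (1 / 2) ⊆ range X.W.ι₂ := X.Dset_subset_range_ι₂ (by norm_num)

/-- The twisted frame is continuous into `T W_U` on `D(1/2)`. [cite: MilnorStasheff1974, §2] -/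
theorem continuousOn_frame₂' (i : ιN n) :
    ContinuousOn (fun p => (TotalSpace.mk' (EuclideanSpace ℝ (Fin (n + 2))) p (X.frame₂' FS FT p i).1 :
      TangentBundle (𝓡∂ (n + 2)) X.P)) (X.Dset (1 / 2)) := by
  have hG := X.continuousOn_Gfun_Dset FS FT
  have ha : ∀ j, ContinuousOn (fun p => X.Gfun FS FT p j i) (X.Dset (1 / 2)) := fun j =>
    (continuousOn_pi.1 (continuousOn_pi.1 hG j)) i
  have h := continuousOn_totalSpaceMk_sum (I := 𝓡∂ (n + 2)) (f := fun p : X.P => p)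
    (w := fun j p => (X.frame₂ FT p j).1) (a := fun j p => X.Gfun FS FT p j i) (t := X.Dset (1 / 2))
    continuousOn_id (fun j => (X.continuousOn_frame₂ FT j).mono X.Dset_half_subset) ha
  refine h.congr fun p _ => ?_
  change (TotalSpace.mk' _ p (X.frame₂' FS FT p i).1 : TangentBundle (𝓡∂ (n + 2)) X.P) =
    TotalSpace.mk' _ p (∑ j, X.Gfun FS FT p j i • (X.frame₂ FT p j).1)
  congr 1
  rw [frame₂', Prod.fst_sum]
  rfl

/-- The real parts of the twisted frame are continuous on `D(1/2)`. [folklore] -/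
theorem continuousOn_frame₂'_snd (i : ιN n) :
    ContinuousOn (fun p => (X.frame₂' FS FT p i).2) (X.Dset (1 / 2)) := by
  have hG := X.continuousOn_Gfun_Dset FS FT
  have h : ContinuousOn (fun p => ∑ j, X.Gfun FS FT p j i * (X.frame₂ FT p j).2) (X.Dset (1 / 2)) :=
    continuousOn_finsetSum _ fun j _ =>
      ((continuousOn_pi.1 (continuousOn_pi.1 hG j)) i).mul ((X.continuousOn_frame₂_snd FT j).mono X.Dset_half_subset)
  refine h.congr fun p _ => ?_
  rw [frame₂', Prod.snd_sum]
  rfl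

/-- **On the seam sphere the twisted second frame is the first frame.** [cite: MilnorStasheff1974, §3] -/
theorem frame₂'_eq_frame₁ {p : X.P} (ht : p ∈ X.Θ.target) (hν : X.ν p = 1 / 2) (i : ιN n) :
    X.frame₂' FS FT p i = X.frame₁ FS p i := by
  have hc : X.Θ (cvec (X.Θ.symm p)) = p := by
    rw [cvec_eq_self hν, X.Θ.right_inv ht]
  rw [frame₂']
  have hG : X.Gfun FS FT p = X.trans FS FT p := by
    unfold Gfun
    rw [if_pos ht, hc]
  rw [hG]
  exact X.sum_trans_smul FS FT ht i

open Classical in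
/-- **The glued stable frame field** of `W_U`: the first frame on `C(1/2)`, the twisted second
frame elsewhere. [cite: KervaireMilnorAnnals1963, §2 p. 508] -/
def gluedFrame (p : X.P) (i : ιN n) : EuclideanSpace ℝ (Fin (n + 2)) × ℝ :=
  if p ∈ X.Cset (1 / 2) then X.frame₁ FS p i else X.frame₂' FS FT p i

/-- The glued frame is the first frame on `C(1/2)`. [folklore] -/
theorem gluedFrame_of_mem {p : X.P} (hp : p ∈ X.Cset (1 / 2)) (i : ιN n) :
    X.gluedFrame FS FT p i = X.frame₁ FS p i := by
  rw [gluedFrame, if_pos hp]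

/-- The glued frame is the twisted second frame on `D(1/2)`. [folklore] -/
theorem gluedFrame_of_mem_Dset {p : X.P} (hp : p ∈ X.Dset (1 / 2)) (i : ιN n) :
    X.gluedFrame FS FT p i = X.frame₂' FS FT p i := by
  rw [gluedFrame]
  split_ifs with hC
  · obtain ⟨ht, hν⟩ := X.mem_target_and_ν_eq_of_mem_inter ⟨hC, hp⟩
    exact (X.frame₂'_eq_frame₁ FS FT ht hν i).symm
  · rfl

/-- The glued frame is continuous into `T W_U`. [cite: MilnorStasheff1974, §2] -/
theorem continuous_gluedFrame (i : ιN n) :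
    Continuous fun p => (TotalSpace.mk' (EuclideanSpace ℝ (Fin (n + 2))) p (X.gluedFrame FS FT p i).1 :
      TangentBundle (𝓡∂ (n + 2)) X.P) := by
  rw [← continuousOn_univ, ← X.Cset_union_Dset (1 / 2)]
  refine ContinuousOn.union_of_isClosed ?_ ?_ (X.isClosed_Cset (by norm_num) (by norm_num)) (X.isClosed_Dset _)
  · refine ((X.continuousOn_frame₁ FS i).mono (X.Cset_subset_range_ι₁ _)).congr fun p hp => ?_
    change (TotalSpace.mk' _ p _ : TangentBundle (𝓡∂ (n + 2)) X.P) = TotalSpace.mk' _ p _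
    rw [X.gluedFrame_of_mem FS FT hp]
  · refine (X.continuousOn_frame₂' FS FT i).congr fun p hp => ?_
    change (TotalSpace.mk' _ p _ : TangentBundle (𝓡∂ (n + 2)) X.P) = TotalSpace.mk' _ p _
    rw [X.gluedFrame_of_mem_Dset FS FT hp]

/-- The real parts of the glued frame are continuous. [folklore] -/
theorem continuous_gluedFrame_snd (i : ιN n) : Continuous fun p => (X.gluedFrame FS FT p i).2 := by
  rw [← continuousOn_univ, ← X.Cset_union_Dset (1 / 2)]
  refine ContinuousOn.union_of_isClosed ?_ ?_ (X.isClosed_Cset (by norm_num) (by norm_num)) (X.isClosed_Dset _)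
  · exact ((X.continuousOn_frame₁_snd FS i).mono (X.Cset_subset_range_ι₁ _)).congr fun p hp => by
      rw [X.gluedFrame_of_mem FS FT hp]
  · exact (X.continuousOn_frame₂'_snd FS FT i).congr fun p hp => by
      rw [X.gluedFrame_of_mem_Dset FS FT hp]

/-- The glued frame is a frame everywhere. [folklore] -/
theorem linearIndependent_gluedFrame (p : X.P) : LinearIndependent ℝ (X.gluedFrame FS FT p) := by
  by_cases hp : p ∈ X.Cset (1 / 2)
  · have h : X.gluedFrame FS FT p = X.frame₁ FS p := funext fun i => X.gluedFrame_of_mem FS FT hp i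
    rw [h]
    exact X.linearIndependent_frame₁ FS p
  · have hD : p ∈ X.Dset (1 / 2) :=
      ((X.Cset_union_Dset (1 / 2)).symm ▸ mem_univ p : p ∈ X.Cset (1 / 2) ∪ X.Dset (1 / 2)).resolve_left hp
    have h : X.gluedFrame FS FT p = X.frame₂' FS FT p := funext fun i => X.gluedFrame_of_mem_Dset FS FT hD i
    rw [h]
    exact X.linearIndependent_frame₂' FS FT p

/-- **The glued stable frame field of `W_S ♮ W_T`.** [cite: KervaireMilnorAnnals1963, §2 p. 508] -/
def gluedStableFrame : StableFrame (n := n) X.P where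
  s i p := X.gluedFrame FS FT p i
  cont := X.continuous_gluedFrame FS FT
  cont₂ := X.continuous_gluedFrame_snd FS FT
  linearIndependent := X.linearIndependent_gluedFrame FS FT

end Glue

/-- **The boundary connected sum of s-parallelizable manifolds is s-parallelizable**
(Kervaire–Milnor 1963, §2 p. 508, with Milnor 1959, Lemma 2.4): if `T W_S ⊕ ℝ` and `T W_T ⊕ ℝ`
are trivial then so is `T(W_S ♮ W_T) ⊕ ℝ`, for the glued manifold `W_U = W_S ♮ W_T` of a
`BCSSetup`. [cite: KervaireMilnorAnnals1963, §2 p. 508] -/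
theorem isStablyParallelizable_glued (hS : IsStablyParallelizable (𝓡∂ (n + 2)) X.cS.W)
    (hT : IsStablyParallelizable (𝓡∂ (n + 2)) X.cT.W) : IsStablyParallelizable (𝓡∂ (n + 2)) X.glued.W := by
  obtain ⟨FS⟩ := nonempty_stableFrame_of_isStablyParallelizable hS
  obtain ⟨FT⟩ := nonempty_stableFrame_of_isStablyParallelizable hT
  exact (X.gluedStableFrame FS FT).isStablyParallelizable

end BCSSetup

end NullCobordism

end Literature.Topology.FourManifolds
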